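import Summits.HubbardSuperconductivity.HubbardSuperconductivity.Theorems.AnisotropyChordTransferFibre3KTAssembly

/-!
# Route `AnisotropyChord` / H0 rotor rung: the one-loop identity layer of PartN31, part 1 — `FsqFourier`, `PiHatOneLoop`, `PolePairingIdentity`

Memo ROTOR-THEORY-21 §297 (theory seat `hubbard-h0-rotor-theory-1`), typed in `…Fibre3BetaFreeTargets`:
* **`fsqFourier_holds : FsqFourier L`** — `FT[f²](q) = V⁻¹ Σ_p f̂(p) f̂(q − p)` (convolution theorem on `(ℤ/L)²`);
* **`piHatOneLoop_holds : PiHatOneLoop L`** — `Π̂⁰(q₂,q₃) = V⁻¹ Σ_p f̂(p) f̂(q₂+p) f̂(q₃−p)` for the product state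
  `Π⁰(a,b) = f(a)f(b)f(b−a)` (one loop in momentum space);
* **`polePairingIdentity_holds : PolePairingIdentity L Δ λ₂`** (every `L, Δ, λ₂`) — `⟨p_j, R′⟩ = ⟨v, R′⟩/3` for each pole
  wave, because the residual `R′` of the symmetric trial state `Ψ¹ = vΠ⁰` is symmetric (`overlaps_eq`).
Prover seat `hubbard-h0-rotor-p1` g22; helper for stmt-HubbardSuperconductivity-19089 (`--supports`).
-/

set_option linter.dupNamespace false
set_option autoImplicit false

noncomputable section

open scoped BigOperators
open Complex

namespace Summit.HubbardSuperconductivity.HubbardSuperconductivity.Theorems.AnisotropyChord.Transfer.Fibre3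

variable (L : ℕ) [NeZero L]

/-! ## Character bookkeeping -/

/-- `Σ_p conj(e^{ip·r}) = [r = 0]·V`. [folklore] -/
theorem sum_conj_phase_left (r : Tor L) :
    ∑ p : Tor L, (starRingEnd ℂ) (phase L p r) = if r = 0 then ((L : ℂ) ^ 2) else 0 := by
  rw [← map_sum, sum_phase_left]
  split_ifs <;> simp

/-- two characters at `p` and `q − p` recombine: `conj φ_p(r)·conj φ_{q−p}(s) = conj φ_q(s)·conj φ_p(r − s)`. [folklore] -/
theorem conj_phase_pair (p q r s : Tor L) :
    (starRingEnd ℂ) (phase L p r) * (starRingEnd ℂ) (phase L (q - p) s)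
      = (starRingEnd ℂ) (phase L q s) * (starRingEnd ℂ) (phase L p (r - s)) := by
  rw [← map_mul, ← map_mul, sub_eq_add_neg q p, phase_add_left, phase_neg_left, sub_eq_add_neg r s, phase_add]
  ring_nf

/-! ## `FsqFourier` -/

/-- **`FsqFourier` holds:** `FT[f²](q) = V⁻¹ Σ_p f̂(p) f̂(q−p)`. [folklore] -/
theorem fsqFourier_holds : FsqFourier L := by
  intro f q
  have hV : ((L : ℂ) ^ 2) ≠ 0 := by
    have : (L : ℂ) ≠ 0 := by exact_mod_cast (NeZero.ne L)
    positivity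
  rw [eq_div_iff hV]
  unfold dft
  -- expand the product of sums
  have e1 : ∑ p : Tor L, (∑ r : Tor L, (starRingEnd ℂ) (phase L p r) * (f r : ℂ))
        * (∑ s : Tor L, (starRingEnd ℂ) (phase L (q - p) s) * (f s : ℂ))
      = ∑ r : Tor L, ∑ s : Tor L, ((f r : ℂ) * (f s : ℂ) * (starRingEnd ℂ) (phase L q s))
          * ∑ p : Tor L, (starRingEnd ℂ) (phase L p (r - s)) := by
    calc ∑ p : Tor L, (∑ r : Tor L, (starRingEnd ℂ) (phase L p r) * (f r : ℂ))
          * (∑ s : Tor L, (starRingEnd ℂ) (phase L (q - p) s) * (f s : ℂ))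
        = ∑ p : Tor L, ∑ r : Tor L, ∑ s : Tor L,
            ((f r : ℂ) * (f s : ℂ) * (starRingEnd ℂ) (phase L q s)) * (starRingEnd ℂ) (phase L p (r - s)) := by
          refine Finset.sum_congr rfl fun p _ => ?_
          rw [Finset.sum_mul_sum]
          refine Finset.sum_congr rfl fun r _ => Finset.sum_congr rfl fun s _ => ?_
          have := conj_phase_pair L p q r s
          calc (starRingEnd ℂ) (phase L p r) * (f r : ℂ) * ((starRingEnd ℂ) (phase L (q - p) s) * (f s : ℂ))
              = ((starRingEnd ℂ) (phase L p r) * (starRingEnd ℂ) (phase L (q - p) s)) * ((f r : ℂ) * (f s : ℂ)) := by ring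
            _ = _ := by rw [this]; ring
      _ = ∑ r : Tor L, ∑ p : Tor L, ∑ s : Tor L,
            ((f r : ℂ) * (f s : ℂ) * (starRingEnd ℂ) (phase L q s)) * (starRingEnd ℂ) (phase L p (r - s)) :=
          Finset.sum_comm
      _ = ∑ r : Tor L, ∑ s : Tor L, ∑ p : Tor L,
            ((f r : ℂ) * (f s : ℂ) * (starRingEnd ℂ) (phase L q s)) * (starRingEnd ℂ) (phase L p (r - s)) := by
          refine Finset.sum_congr rfl fun r _ => ?_; exact Finset.sum_comm
      _ = _ := by
          refine Finset.sum_congr rfl fun r _ => Finset.sum_congr rfl fun s _ => ?_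
          rw [Finset.mul_sum]
  rw [e1]
  -- the character sum kills `s ≠ r`
  have e2 : ∀ r : Tor L, ∑ s : Tor L, ((f r : ℂ) * (f s : ℂ) * (starRingEnd ℂ) (phase L q s))
        * ∑ p : Tor L, (starRingEnd ℂ) (phase L p (r - s))
      = (starRingEnd ℂ) (phase L q r) * (((f r ^ 2 : ℝ)) : ℂ) * (L : ℂ) ^ 2 := by
    intro r
    simp_rw [sum_conj_phase_left, sub_eq_zero]
    have : ∀ s : Tor L, ((f r : ℂ) * (f s : ℂ) * (starRingEnd ℂ) (phase L q s)) * (if r = s then ((L : ℂ) ^ 2) else 0)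
        = if r = s then (f r : ℂ) * (f s : ℂ) * (starRingEnd ℂ) (phase L q s) * (L : ℂ) ^ 2 else 0 := by
      intro s; split_ifs <;> ring
    rw [Finset.sum_congr rfl fun s _ => this s, Finset.sum_ite_eq Finset.univ r]
    simp only [Finset.mem_univ, if_true]
    push_cast; ring
  rw [Finset.sum_congr rfl fun r _ => e2 r, ← Finset.sum_mul]

/-! ## `PiHatOneLoop` -/

/-- three characters recombine: `conj φ_p(r)·conj φ_{q₂+p}(s)·conj φ_{q₃−p}(t) = conj(φ_{q₂}(s)φ_{q₃}(t))·conj φ_p(r+s−t)`.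
[folklore] -/
theorem conj_phase_triple (p q₂ q₃ r s t : Tor L) :
    (starRingEnd ℂ) (phase L p r) * (starRingEnd ℂ) (phase L (q₂ + p) s) * (starRingEnd ℂ) (phase L (q₃ - p) t)
      = (starRingEnd ℂ) (phase L q₂ s * phase L q₃ t) * (starRingEnd ℂ) (phase L p (r + s - t)) := by
  rw [← map_mul, ← map_mul, ← map_mul, phase_add_left, sub_eq_add_neg q₃ p, phase_add_left, phase_neg_left,
    sub_eq_add_neg (r + s) t, phase_add, phase_add]
  ring_nf

/-- **`PiHatOneLoop` holds:** `Π̂⁰(q₂,q₃) = V⁻¹ Σ_p f̂(p) f̂(q₂+p) f̂(q₃−p)`. [folklore] -/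
theorem piHatOneLoop_holds : PiHatOneLoop L := by
  intro f q₂ q₃
  have hV : ((L : ℂ) ^ 2) ≠ 0 := by
    have : (L : ℂ) ≠ 0 := by exact_mod_cast (NeZero.ne L)
    positivity
  rw [eq_div_iff hV]
  unfold dft cfgDFT
  -- expand the triple product
  have e1 : ∑ p : Tor L, (∑ r : Tor L, (starRingEnd ℂ) (phase L p r) * (f r : ℂ))
        * (∑ s : Tor L, (starRingEnd ℂ) (phase L (q₂ + p) s) * (f s : ℂ))
        * (∑ t : Tor L, (starRingEnd ℂ) (phase L (q₃ - p) t) * (f t : ℂ))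
      = ∑ s : Tor L, ∑ t : Tor L, ∑ r : Tor L,
          ((f r : ℂ) * (f s : ℂ) * (f t : ℂ) * (starRingEnd ℂ) (phase L q₂ s * phase L q₃ t))
            * ∑ p : Tor L, (starRingEnd ℂ) (phase L p (r + s - t)) := by
    calc ∑ p : Tor L, (∑ r : Tor L, (starRingEnd ℂ) (phase L p r) * (f r : ℂ))
          * (∑ s : Tor L, (starRingEnd ℂ) (phase L (q₂ + p) s) * (f s : ℂ))
          * (∑ t : Tor L, (starRingEnd ℂ) (phase L (q₃ - p) t) * (f t : ℂ))
        = ∑ p : Tor L, ∑ r : Tor L, ∑ s : Tor L, ∑ t : Tor L,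
            ((f r : ℂ) * (f s : ℂ) * (f t : ℂ) * (starRingEnd ℂ) (phase L q₂ s * phase L q₃ t))
              * (starRingEnd ℂ) (phase L p (r + s - t)) := by
          refine Finset.sum_congr rfl fun p _ => ?_
          rw [Finset.sum_mul_sum, Finset.sum_mul]
          refine Finset.sum_congr rfl fun r _ => ?_
          rw [Finset.sum_mul]
          refine Finset.sum_congr rfl fun s _ => ?_
          rw [Finset.mul_sum]
          refine Finset.sum_congr rfl fun t _ => ?_
          have := conj_phase_triple L p q₂ q₃ r s t
          calc (starRingEnd ℂ) (phase L p r) * (f r : ℂ) * ((starRingEnd ℂ) (phase L (q₂ + p) s) * (f s : ℂ))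
                * ((starRingEnd ℂ) (phase L (q₃ - p) t) * (f t : ℂ))
              = ((starRingEnd ℂ) (phase L p r) * (starRingEnd ℂ) (phase L (q₂ + p) s)
                  * (starRingEnd ℂ) (phase L (q₃ - p) t)) * ((f r : ℂ) * (f s : ℂ) * (f t : ℂ)) := by ring
            _ = _ := by rw [this]; ring
      _ = ∑ r : Tor L, ∑ p : Tor L, ∑ s : Tor L, ∑ t : Tor L,
            ((f r : ℂ) * (f s : ℂ) * (f t : ℂ) * (starRingEnd ℂ) (phase L q₂ s * phase L q₃ t))
              * (starRingEnd ℂ) (phase L p (r + s - t)) := Finset.sum_comm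
      _ = ∑ r : Tor L, ∑ s : Tor L, ∑ p : Tor L, ∑ t : Tor L,
            ((f r : ℂ) * (f s : ℂ) * (f t : ℂ) * (starRingEnd ℂ) (phase L q₂ s * phase L q₃ t))
              * (starRingEnd ℂ) (phase L p (r + s - t)) := by
          refine Finset.sum_congr rfl fun r _ => ?_; exact Finset.sum_comm
      _ = ∑ r : Tor L, ∑ s : Tor L, ∑ t : Tor L, ∑ p : Tor L,
            ((f r : ℂ) * (f s : ℂ) * (f t : ℂ) * (starRingEnd ℂ) (phase L q₂ s * phase L q₃ t))
              * (starRingEnd ℂ) (phase L p (r + s - t)) := by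
          refine Finset.sum_congr rfl fun r _ => Finset.sum_congr rfl fun s _ => ?_; exact Finset.sum_comm
      _ = ∑ r : Tor L, ∑ s : Tor L, ∑ t : Tor L,
            ((f r : ℂ) * (f s : ℂ) * (f t : ℂ) * (starRingEnd ℂ) (phase L q₂ s * phase L q₃ t))
              * ∑ p : Tor L, (starRingEnd ℂ) (phase L p (r + s - t)) := by
          refine Finset.sum_congr rfl fun r _ => Finset.sum_congr rfl fun s _ => Finset.sum_congr rfl fun t _ => ?_
          rw [Finset.mul_sum]
      _ = ∑ s : Tor L, ∑ r : Tor L, ∑ t : Tor L,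
            ((f r : ℂ) * (f s : ℂ) * (f t : ℂ) * (starRingEnd ℂ) (phase L q₂ s * phase L q₃ t))
              * ∑ p : Tor L, (starRingEnd ℂ) (phase L p (r + s - t)) := Finset.sum_comm
      _ = _ := by
          refine Finset.sum_congr rfl fun s _ => ?_; exact Finset.sum_comm
  rw [e1]
  -- the character sum forces `t = r + s`
  have e2 : ∀ s t : Tor L, ∑ r : Tor L,
        ((f r : ℂ) * (f s : ℂ) * (f t : ℂ) * (starRingEnd ℂ) (phase L q₂ s * phase L q₃ t))
          * ∑ p : Tor L, (starRingEnd ℂ) (phase L p (r + s - t))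
      = (starRingEnd ℂ) (phase L q₂ s * phase L q₃ t) * (((f s * f t * f (t - s) : ℝ)) : ℂ) * (L : ℂ) ^ 2 := by
    intro s t
    simp_rw [sum_conj_phase_left]
    have hcond : ∀ r : Tor L, (r + s - t = 0) ↔ (r = t - s) := by
      intro r; constructor <;> intro h
      · have := congrArg (· + (t - s)) h; simp at this; linear_combination h
      · rw [h]; abel
    have : ∀ r : Tor L, ((f r : ℂ) * (f s : ℂ) * (f t : ℂ) * (starRingEnd ℂ) (phase L q₂ s * phase L q₃ t))
          * (if r + s - t = 0 then ((L : ℂ) ^ 2) else 0)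
        = if r = t - s then (f r : ℂ) * (f s : ℂ) * (f t : ℂ) * (starRingEnd ℂ) (phase L q₂ s * phase L q₃ t) * (L : ℂ) ^ 2
          else 0 := by
      intro r; rw [if_congr (hcond r) rfl rfl]; split_ifs <;> ring
    rw [Finset.sum_congr rfl fun r _ => this r, Finset.sum_ite_eq' Finset.univ (t - s)]
    simp only [Finset.mem_univ, if_true]
    push_cast; ring
  simp_rw [e2]
  rw [Fintype.sum_prod_type, Finset.sum_mul]
  refine Finset.sum_congr rfl fun s _ => ?_
  rw [Finset.sum_mul]
  refine Finset.sum_congr rfl fun t _ => ?_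
  rfl

/-! ## `PolePairingIdentity` -/

/-- the residual of the symmetric trial state is symmetric. [folklore] -/
theorem isSymm_resid {Δ lam2 : ℝ} {f : Tor L → ℝ} (hf : IsGroundTwoMagnon L Δ lam2 f) :
    IsSymm L (K1 L) (resid L Δ f) := by
  have h := restrict_mem_symD L (K1 L)
    (isSymm_residual L (K1 L) Δ (eps1 L + Tplus L Δ f) (isSymm_trialK1 L hf))
  exact h.1

/-- **`PolePairingIdentity` holds** (every `L, Δ, λ₂`): `⟨p_j, R′⟩ = ⟨v, R′⟩/3`. [folklore] -/
theorem polePairingIdentity_holds (Δ lam2 : ℝ) : PolePairingIdentity L Δ lam2 := by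
  intro f hf j
  have hsym := isSymm_resid L hf
  obtain ⟨h0, h2⟩ := overlaps_eq L hsym
  have hv := ip_vfun_eq L hsym
  have e0 : poleWave L 0 = pw L 0 0 := funext fun c => (poleWave_eq L c).1
  have e1 : poleWave L 1 = pw L (K1 L) 0 := funext fun c => (poleWave_eq L c).2.1
  have e2 : poleWave L 2 = pw L 0 (K1 L) := funext fun c => (poleWave_eq L c).2.2
  rw [hv]
  fin_cases j
  · show ip L (poleWave L 0) (resid L Δ f) = _
    rw [e0, h0]; ring
  · show ip L (poleWave L 1) (resid L Δ f) = _
    rw [e1]; ring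
  · show ip L (poleWave L 2) (resid L Δ f) = _
    rw [e2, h2]; ring

end Summit.HubbardSuperconductivity.HubbardSuperconductivity.Theorems.AnisotropyChord.Transfer.Fibre3

end
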